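import Summits.QuantumFields.YangMills.Theorems.BalabanUVNodesK0AxJunctionRootGrad

/-!
# NODE O · K0ᴬ — THE P0 JUNCTION SOCKET «ROOTING IS A GRADIENT AT FIRST ORDER»: the receipts (C-wcg) ∕ (C-orb) ∕ (C-crit) ∕ (C-cons) of the ROOTED response
# `recordD` TRANSFER VERBATIM to the response of ANY chart `U(B)` with `recordBgField = rootGauge ∘ U` near `B = 0`; instantiated at node00-def-Y's `BgScheme.chartCfg`

LANDING NOTE (porter ▶ PTC-1 g4, 2026-08-31; AUTHORSHIP = ◇ lens-1 g11 «cauchy-analytic», HOME sketch `nodeO-cover/LENS-1g11-JunctionRootGrad-v1.lean` sha16 ef4e791fbbd67beb · 544 l. · 6 def + 23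
thm · 0 sorry): the HOME file exceeds the gate's 400-line cap, so it is landed as THREE files by a MECHANICAL split (◇ lens-1 g11's OPTION (b) three-file variant, nodeO STATUS 11:07:50Z; generator
`work/gen/build_split_rootgrad3.py` of this seat; docstrings, statements and proofs BYTE-IDENTICAL to the HOME sketch; imports as the monolith): FILE 1
`…Theorems/BalabanUVNodesK0AxRootGradCalc.lean` = header + §1 (ns `K0AxRootGrad`: generic calculus of the rooted gauge at the unit configuration), FILE 2
`…Theorems/BalabanUVNodesK0AxJunctionRootGrad.lean` = header + `import …K0AxRootGradCalc` + §2 (ns `K0AxCtabUniq`: `chartRespD`, the displayed chart-level letters, rooted ⟺ chart transfer of the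
receipts), FILE 3 `…Theorems/BalabanUVNodesK0AxJunctionRootGradScheme.lean` = header + `import …K0AxJunctionRootGrad` + §2's namespace∕`open`∕`variable` preamble + §3 (`section Scheme`: the def-Y
`BgScheme` ∕ KNIT instances). THIS IS FILE 3 OF 3 (the others: `…K0AxRootGradCalc` ∕ `…K0AxJunctionRootGrad`).  Landed on ◇ lens-1 g11's CANDIDATE 1 (nodeO STATUS 11:05:04Z), after ✓p820208
`…K0AxCtabOrbitIffCrit` (B-5) and node00-def-Y's ✓`…N07P0FixedPointIsRecordMinimiserAtChart`; ◆ CRIT-1 g37's cut + J1′∕J4∕J5′ stamp: SAME-WALL verdict SURVIVES (PRICED); CUT = GO THREE-FILE (b) AS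
STAGED (INTENT-53∕54∕55); J1′ ∕ J4 ∕ J5′ ∕ (Q-ord) ∕ (Q-bridge) PASS; axioms standard on ◆'s monolith run; price displayed: (p1) `ChartResponseWeaklyCriticalAt` at def-Y's chart — print's
statement ONLY for a scheme whose `bg` is the CONSTANT flat `U₀` and whose chart is the (21)-Landau-gauge representative ([15] §G p.305, (174)–(178)); def-Y's `bgSchemeOfRecord` qualifies, for any
other representative of the orbit `chartRespD` shifts by a gradient and (p1) runs into the STRUCK (C-tab-opt) wall — plus (p2) factorisation tokens, (p3) `chartCfg 1 = 1` ∕ C² chart entries, (p4)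
range guard, and the two flat dictionaries (J-crit)∕(J-cons), all OPEN (nodeO STATUS 2026-08-31T11:13:06Z); helper `--supports stmt-QuantumFields-27238 --as helper` (NO `--workitem`).  HONEST
(porter): calculus of finite matrix products + bookkeeping; CONDITIONAL theorems over DISPLAYED letters (`RootFactorAt`, `ChartRegAt`, `ChartResponseWeaklyCriticalAt`, def-Y∕KNIT tokens — all
OPEN, asserted nowhere); (C-tab-opt) stays STRUCK; nothing of Bałaban asserted, ported, discharged or refuted; K0ᴬ stmt-QuantumFields-27238 ∕ K0⁷ 20541 OPEN — NOTHING of them proved; NODE O 0∕1;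
COUNT 8∕28 · K 1∕4 UNMOVED; finite 𝕋⁴ at fixed ε — NOT continuum ∕ OS ∕ Clay; the Yang–Mills mass gap is NOT proved by any of this.

◇ `ymgap-nodeO-lens-1` g11 (planner; typed for the porter ▶ PTC-1; proposed basename `…/Theorems/BalabanUVNodesK0AxJunctionRootGrad.lean`,
`--supports stmt-QuantumFields-27238 --as helper`).  Items: K0ᴬ stmt-QuantumFields-27238 OPEN; K0⁷ stmt-QuantumFields-20541 OPEN.  [15] = [Balaban1985Variational],
[I] = [Balaban1987RG1], [B6] = [Balaban1984PropagatorsII].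

WHY.  After B-5 (✓`…K0AxCtabOrbitIffCrit`) the one displayed NON-P0-token leaf of the (R-a) road is (C-orb) ⟺ (C-wcg) ⟺ (C-crit) ∧ (C-cons), all stated on the ROOTED
table `recordD := D|₀ (entries of UkSel F 2 K (k+1) εbg (unitField B))`.  Their supplier is P0 = node00-def-Y's `BgScheme` ([15] Prop. 6 ∕ Thm 1 as a named map:
✓`Node00.BackgroundMapOfRecord`, ✓`…BgSchemeOfRecordC`, (s2) `…BgSchemeOfRecordEL`), which speaks of the CHART IMAGE `chartCfg S V` of the (116)-fixed point, while the
selector adds the ROOTED GAUGE: ✓`UkSel_eq_rootGauge_chartCfg_of_orbitRel` («`UkSel V = rootGauge (chartCfg S V)`» under the (11′)-tokens).  The seam (◆ Q-27: «the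
real-side identification `recordBgField = chart ∘ …` is in NO file») is closed here by ONE calculus fact: at the unit configuration the rooted gauge `U ↦ U^{g_U}`
(`T4RootedResidualGauge.rootGauge`, `g_U(x)` = holonomy along the coordinate path from the block root) has derivative `Y ↦ Y + (Ψ(b₋) − Ψ(b₊))`, `Ψ := D g(1)`, i.e.
ROOTING CONTRIBUTES A PURE (unrestricted) GRADIENT — and every receipt of the road is a statement MODULO unrestricted gradients.  So the receipts for `recordD` are
EQUIVALENT to the same receipts for the chart response `chartRespD U := D|₀ (entries of U(B))`, for ANY factorisation `recordBgField =ᶠ rootGauge (k+1) ∘ U` with `U(0) = 1`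
and differentiable entries; no property of the selector, no Landau representative, no `N(Q′)`-clause is used, and NO identity `recordD = (transverse table)` is stated (J5′).

WHAT IS PROVED (kernel, sorry-free, standard axioms).
§1 (generic, any real normed parameter space `E`, any `Params`): `differentiableAt_coe_lineHol ∕ _pathHol ∕ _rootTransporter` and the `Cⁿ` twins `contDiffAt_coe_lineHol ∕ _pathHol ∕
   _rootGauge` (finite products and adjoints); ★ `hasFDerivAt_coe_rootGauge`:
   if `U e₀ = 1` and the bond matrices of `U e` are differentiable at `e₀`, then `e ↦ (rootGauge k (U e))(b)` has derivative `DU(b) + (Ψ b.src − Ψ b.tgt)` at `e₀` with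
   `Ψ x := D(e ↦ g_{U e}(x))(e₀)` anti-Hermitian-valued (`star (Ψ x v) = −Ψ x v`, from `g ∈ SU(2)`).
§2 (K0 letters, namespace `K0AxCtabUniq`): `chartRespD` (the chart twin of ✓`recordD`); displayed letters `RootFactorAt` (factorisation), `ChartRegAt`, `ChartResponseCriticalModGaugeAt`,
   `ChartResponseWeaklyCriticalAt`; ★★ `recordD_eq_chartRespD_add_grad` (under the factorisation token: `recordD a l b = chartRespD U a l b + (ψ(b₋) − ψ(b₊))`); ★★
   `contDiffAt_recordBgField_entries_of_chart` (TokP9reg♭ᵣ — `Cⁿ` entries of `recordBgField` at `0` — FROM `Cⁿ` chart entries, `n = 2` the displayed letter of ✓`twoVolExp_orbit_images`); ★★ `rootedResponseOrbitAt_iff_chart`, ★★ `criticalModGauge_iff_chart` ((C-orb), (C-wcg) are INVARIANT under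
   the passage rooted ↔ chart); ★★★ `criticalModGauge_of_chart_weaklyCritical`: if the chart response ITSELF is weakly critical (the `φ₀ = 0` shape — legitimate for a chart in
   the (21)-Landau gauge, unlike for the rooted table where it is the STRUCK (C-tab-opt)), then (C-wcg), hence (C-orb) (✓`rootedResponseOrbitAt_of_criticalModGauge`) and
   (C-crit) ∧ (C-cons) (✓`criticalModGauge_iff_invCritical_and_constraintModGauge`).
§3 (the def-Y instance): `ChartMinimiserResTok` (DISPLAYED: the Prop-7 gauge transform of `Prop7Tok` may be taken RESIDUAL of level `k+1` — p. 299 «U_k = (U₁U₀)^u» with `u`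
   the axial∕rooted normaliser); ★★ `eventually_recordBgField_eq_rootGauge_chartCfg` (the factorisation token FROM `UniqTok` + `ChartMinimiserResTok` + «charted fields near
   `B = 0` lie in the (7)-domain», by ✓`UkSel_eq_rootGauge_chartCfg_of_orbitRel`); ★★★ `rootedReceipts_of_bgScheme`: the four receipts (C-wcg) ∕ (C-orb) ∕ (C-crit) ∕ (C-cons)
   for ALL `a l` FROM the displayed scheme-level letters {`UniqTok`, `ChartMinimiserResTok`, domain near flat, `chartCfg S 1 = 1`, differentiable chart entries at `B = 0`,
   chart response weakly critical}, and ★★ `tokP9reg_of_bgScheme` (TokP9reg♭ᵣ from the same tokens + `C²` chart entries) — so EVERY non-D1 leaf of ✓`twoVolExp_orbit_images` is now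
   addressed at scheme level; ★★ `rootFactorAt_of_tokens_chart` ∕ ★★★ `rootedReceipts_of_tokens_chart`: the same with the factorisation supplied by the N07∕P0 KNIT
   (✓`N07P0FixedPointIsRecordMinimiser.ukSel_eq_rootGauge_chartCfg_of_tokens_chart`, dag-n07-w3: tokens (rng)(cov)(c→s)(min) at `S.chart V` + `S.RegimeTok`) instead of
   `UniqTok` + `ChartMinimiserResTok`; ★★★ `rootedReceipts_of_chart`: the four receipts from the three chart-level letters for ANY chart.  The weak-criticality letter is
   exactly what (s2)∕(s3) of node00-def-Y (EL (111) + constraint (109) + Hessian at the flat background) are to deliver,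
   now addressed to the CHART, where print states it ([15] (176)–(178), [B6] (2.35)), and no longer to the selector.

HONEST.  Calculus of finite matrix products + bookkeeping; CONDITIONAL theorems over DISPLAYED letters; nothing of Bałaban ([15] Thm 1, Prop. 6–9, (176)–(178); [B6] (2.35);
[I] (4.35)) is asserted, ported or discharged; (C-tab-opt) stays STRUCK; P0's tokens, D1 ⟨27930⟩, TokP9reg♭, (Tok-cmpU-cap) OPEN; K0ᴬ 27238 ∕ K0⁷ 20541 OPEN — NOTHING of them
proved; NODE O 0∕1; COUNT 8∕28 · K 1∕4 UNMOVED; finite 𝕋⁴_{L^K} at fixed ε — NOT continuum ∕ OS ∕ Clay; **the Yang–Mills mass gap is NOT proved by any of this.**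
No `sorry`, no `instance ∕ notation ∕ set_option`; standard axioms.
-/

noncomputable section

open Filter Topology
open scoped BigOperators Matrix.Norms.L2Operator

/-! ## §3  The instance: node00-def-Y's `BgScheme` chart of the (116)-fixed point -/

namespace Summit.QuantumFields.YangMills.Theorems.K0AxCtabUniq

open Literature.MathematicalPhysics.QuantumFieldTheory.Balaban1983to89
open LatticeFieldCalculus B6SectADomainsV1 B6SectAOperatorsV1 B6SectAVectorModelV1 B6SectACriticalPointV1
open Literature.MathematicalPhysics.QuantumFieldTheory.Balaban1983to89.T4Continuum (T4Family)
open Literature.MathematicalPhysics.QuantumFieldTheory.Balaban1983to89.Node00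
open T4RootedResidualGauge (rootGauge)
open GaugeField (gaugeAct)
open B12GaugeOrbits021 (IsResidual OrbitRel)
open B11Prop6Scheme (mapT)
open Summit.QuantumFields.YangMills.Theorems.K0RecordFormatNames
open Summit.QuantumFields.YangMills.Theorems.K0AxRootGrad

variable (F : T4Family) (θ : Stage13Params F 2)

section Scheme

variable {𝒴 𝒵 : Type} [NormedAddCommGroup 𝒴] [NormedSpace ℂ 𝒴] [NormedAddCommGroup 𝒵] [NormedSpace ℂ 𝒵]

/-- **TOKEN `ChartMinimiserResTok`** (Prop. 7 at the instance, RESIDUAL form): for every `V` of the (7)-domain some gauge transform `u` RESIDUAL of level `k+1` (`u = 1` on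
`T⁽ᵏ⁺¹⁾`) makes the chart image of the fixed point a (0.21)-minimiser over `V` — p. 299 «U_k = (U₁U₀)^u» with `u` the axial (here: rooted) normaliser; it refines
✓`BgScheme.Prop7Tok` by the one word «residual» that ✓`UkSel_eq_rootGauge_chartCfg_of_orbitRel` consumes.  OPEN at the record; DISPLAYED. [cite: Balaban1985Variational, Prop. 7 p.299, (141)–(142) p.299, (19) p.281] -/
def ChartMinimiserResTok (K k : ℕ) (S : BgScheme F 2 𝒴 𝒵 K (k + 1)) (ε : ℝ) : Prop :=
  ∀ V ∈ S.dom, ∃ u : GaugeTransf (F.P K) 0 (SU 2), IsResidual (k + 1) u ∧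
    IsBackground (avOfRecord F 2 K) (bgReg F 2 K (k + 1) ε) (k + 1) V (gaugeAct u (S.chartCfg V))

/-- ★★ **THE FACTORISATION TOKEN FROM THE (11′)-TOKENS**: under `UniqTok`, `ChartMinimiserResTok` and «the charted configurations `unitField B` lie in the (7)-domain for `B`
near `0`», `recordBgField B = rootGauge (k+1) (chartCfg S (unitField B))` near `B = 0` (✓`UkSel_eq_rootGauge_chartCfg_of_orbitRel`; no calculus of the selector).
[cite: Balaban1985Variational, Thm 1 p.279, Prop. 7 p.299, (19) p.281] -/
theorem eventually_recordBgField_eq_rootGauge_chartCfg (k K : ℕ) (hk : k + 1 ≤ (F.P K).m + (F.P K).K) (S : BgScheme F 2 𝒴 𝒵 K (k + 1))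
    (hU : S.UniqTok θ.εbg) (h7 : ChartMinimiserResTok F K k S θ.εbg)
    (hdom : letI := θ.instVβ₁; letI := θ.instVβ₂;
      ∀ᶠ B in 𝓝 (0 : Fin (F.P K).d → Site (F.P K) (k + 1) → θ.Vβ), unitField F θ k K B ∈ S.dom) :
    RootFactorAt F θ k K fun B => S.chartCfg (unitField F θ k K B) := by
  letI := θ.instVβ₁; letI := θ.instVβ₂
  refine hdom.mono fun B hB => ?_
  obtain ⟨u, hu, h₀⟩ := h7 _ hB
  show UkSel F 2 K (k + 1) θ.εbg (unitField F θ k K B) = _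
  exact BgScheme.UkSel_eq_rootGauge_chartCfg_of_orbitRel hk (hU _ hB) h₀ ⟨u, hu, rfl⟩

/-- ★★★ **THE FOUR ROOTED RECEIPTS FROM SCHEME-LEVEL LETTERS.**  On `k + 1 ≤ m + K`, for node00-def-Y's scheme `S` at level `k+1`: `UniqTok`, `ChartMinimiserResTok`, the domain
letter, the flat value `chartCfg S 1 = 1`, differentiable chart entries at `B = 0`, and weak criticality of the CHART response give (C-wcg), (C-orb), (C-crit), (C-cons) for every
colour `a` and label `l` — the (R-a) road's leaf re-addressed from the selector `UkSel` to the chart, where [15] (176)–(178) ∕ [B6] (2.35) state it.  CONDITIONAL; every letter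
DISPLAYED. [cite: Balaban1985Variational, Thm 1 p.279, Prop. 7 p.299, Prop. 9 p.309, (176)–(178) p.306; Balaban1984PropagatorsII, (2.35) p.228; Balaban1987RG1, (4.35) p.290] -/
theorem rootedReceipts_of_bgScheme (k K : ℕ) (hk : k + 1 ≤ (F.P K).m + (F.P K).K) (S : BgScheme F 2 𝒴 𝒵 K (k + 1))
    (hU : S.UniqTok θ.εbg) (h7 : ChartMinimiserResTok F K k S θ.εbg)
    (hdom : letI := θ.instVβ₁; letI := θ.instVβ₂;
      ∀ᶠ B in 𝓝 (0 : Fin (F.P K).d → Site (F.P K) (k + 1) → θ.Vβ), unitField F θ k K B ∈ S.dom)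
    (h1 : S.chartCfg 1 = 1)
    (hdiff : letI := θ.instVβ₁; letI := θ.instVβ₂;
      ∀ b : PBond (F.P K) 0, DifferentiableAt ℝ (fun B : Fin (F.P K).d → Site (F.P K) (k + 1) → θ.Vβ =>
        ((S.chartCfg (unitField F θ k K B) b : SU 2) : MatA 2)) 0)
    (hwc : ∀ a l, ChartResponseWeaklyCriticalAt F θ k K (fun B => S.chartCfg (unitField F θ k K B)) a l) (a : θ.ιβ) (l : RespLabel F k K) :
    RootedResponseCriticalModGaugeAt F θ k K a l ∧ RootedResponseOrbitAt F θ k K a l ∧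
      RootedResponseInvCriticalAt F θ k K a l ∧ RootedResponseConstraintModGaugeAt F θ k K a l := by
  letI := θ.instVβ₁; letI := θ.instVβ₂
  have hfac := eventually_recordBgField_eq_rootGauge_chartCfg F θ k K hk S hU h7 hdom
  have hreg : ChartRegAt F θ k K fun B => S.chartCfg (unitField F θ k K B) := by
    refine ⟨?_, hdiff⟩
    show S.chartCfg (unitField F θ k K 0) = 1
    rw [PortU8.unitField_zero, h1]
  have hw := criticalModGauge_of_chart_weaklyCritical F θ k K _ hfac hreg a l (hwc a l)
  exact ⟨hw, rootedResponseOrbitAt_of_criticalModGauge F θ k K hk a l hw,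
    (criticalModGauge_iff_invCritical_and_constraintModGauge F θ k K a l).1 hw⟩

/-- ★★ **TokP9reg♭ FROM SCHEME-LEVEL LETTERS**: `UniqTok`, `ChartMinimiserResTok`, the domain letter and `C²` chart entries at `B = 0` give the displayed C²-letter of the
rooted background field of record. CONDITIONAL; every letter DISPLAYED. [cite: Balaban1985Variational, Thm 1 p.279, Prop. 7 p.299, Prop. 9 p.309] -/
theorem tokP9reg_of_bgScheme {n : WithTop ℕ∞} (k K : ℕ) (hk : k + 1 ≤ (F.P K).m + (F.P K).K) (S : BgScheme F 2 𝒴 𝒵 K (k + 1))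
    (hU : S.UniqTok θ.εbg) (h7 : ChartMinimiserResTok F K k S θ.εbg)
    (hdom : letI := θ.instVβ₁; letI := θ.instVβ₂;
      ∀ᶠ B in 𝓝 (0 : Fin (F.P K).d → Site (F.P K) (k + 1) → θ.Vβ), unitField F θ k K B ∈ S.dom)
    (hC : letI := θ.instVβ₁; letI := θ.instVβ₂;
      ∀ b : PBond (F.P K) 0, ContDiffAt ℝ n (fun B : Fin (F.P K).d → Site (F.P K) (k + 1) → θ.Vβ =>
        ((S.chartCfg (unitField F θ k K B) b : SU 2) : MatA 2)) 0) :
    letI := θ.instVβ₁; letI := θ.instVβ₂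
    ContDiffAt ℝ n (fun B : Fin (F.P K).d → Site (F.P K) (k + 1) → θ.Vβ =>
      fun (b : PBond (F.P K) 0) (i i' : Fin 2) => ((recordBgField F θ k K B b : SU 2) : Matrix (Fin 2) (Fin 2) ℂ) i i') 0 :=
  contDiffAt_recordBgField_entries_of_chart F θ k K _ (eventually_recordBgField_eq_rootGauge_chartCfg F θ k K hk S hU h7 hdom) hC

/-- ★★ **THE FACTORISATION TOKEN FROM THE N07∕P0 KNIT** (✓`N07P0FixedPointIsRecordMinimiser.ukSel_eq_rootGauge_chartCfg_of_tokens_chart`, dag-n07-w3 Part III):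
the four chart tokens (rng)(cov)(c→s)(min) at def-Y's chart map `S.chart V` for every `V ∈ S.dom`, `S.RegimeTok`, and «charted fields near `B = 0` lie in the
(7)-domain» ⟹ `recordBgField B = rootGauge (k+1) (chartCfg S (unitField B))` near `B = 0` — NO token of this file is used (in particular not
`ChartMinimiserResTok`: under (rng) the chart image is itself the minimiser, `u = 1`). CONDITIONAL; every letter DISPLAYED. [cite: Balaban1985Variational, Thm 1 p.279, Prop. 6 p.295, Prop. 7 p.299, (174) p.305; Balaban1987RG1, (1.1) p.260, (2.3) p.265] -/
theorem rootFactorAt_of_tokens_chart [CompleteSpace 𝒴] (k K : ℕ) (hk : k + 1 ≤ (F.P K).m + (F.P K).K) (S : BgScheme F 2 𝒴 𝒵 K (k + 1))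
    (hR : S.RegimeTok) (Kc : GaugeField (F.P K) (k + 1) (SU 2) → Set 𝒴)
    (range : ∀ V ∈ S.dom, ∀ A ∈ Kc V, S.chart V A ∈ bgReg F 2 K (k + 1) θ.εbg ∧ Averaging.iter (avOfRecord F 2 K) (k + 1) (S.chart V A) = V)
    (covers : ∀ V ∈ S.dom, ∀ U : GaugeField (F.P K) 0 (SU 2), U ∈ bgReg F 2 K (k + 1) θ.εbg →
      Averaging.iter (avOfRecord F 2 K) (k + 1) U = V → ∃ A ∈ Kc V, OrbitRel (k + 1) (S.chart V A) U)
    (sol_of_isMinOn : ∀ V ∈ S.dom, ∀ A ∈ Kc V, IsMinOn (wilsonAction4 ∘ S.chart V) (Kc V) A →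
      ‖A‖ ≤ S.ε₄ ∧ mapT (S.𝒢 V) 0 (S.W V) (S.J V) (S.𝔄 V) A = A)
    (star_mem : ∀ V ∈ S.dom, S.sol V ∈ Kc V) (star_isMinOn : ∀ V ∈ S.dom, IsMinOn (wilsonAction4 ∘ S.chart V) (Kc V) (S.sol V))
    (hdom : letI := θ.instVβ₁; letI := θ.instVβ₂;
      ∀ᶠ B in 𝓝 (0 : Fin (F.P K).d → Site (F.P K) (k + 1) → θ.Vβ), unitField F θ k K B ∈ S.dom) :
    RootFactorAt F θ k K fun B => S.chartCfg (unitField F θ k K B) := by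
  letI := θ.instVβ₁; letI := θ.instVβ₂
  refine hdom.mono fun B hB => ?_
  show UkSel F 2 K (k + 1) θ.εbg (unitField F θ k K B) = _
  exact N07P0FixedPointIsRecordMinimiser.ukSel_eq_rootGauge_chartCfg_of_tokens_chart hk hR hB (range _ hB) (covers _ hB)
    (sol_of_isMinOn _ hB) (star_mem _ hB) (star_isMinOn _ hB)

/-- ★★★ **THE FOUR ROOTED RECEIPTS + TokP9reg♭ FROM THE KNIT TOKENS AND CHART-LEVEL LETTERS**: (rng)(cov)(c→s)(min) + `S.RegimeTok` + domain letter (⟹ factorisation),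
`chartCfg S 1 = 1`, `C²` chart entries at `B = 0`, weak criticality of the chart response ⟹ (C-wcg) ∧ (C-orb) ∧ (C-crit) ∧ (C-cons) for all `a l`, and TokP9reg♭ᵣ.
CONDITIONAL; every letter DISPLAYED; nothing of [15] asserted. [cite: Balaban1985Variational, Thm 1 p.279, Prop. 6 p.295, Prop. 7 p.299, Prop. 9 p.309, (176)–(178) p.306; Balaban1984PropagatorsII, (2.35) p.228; Balaban1987RG1, (4.35) p.290] -/
theorem rootedReceipts_of_tokens_chart [CompleteSpace 𝒴] (k K : ℕ) (hk : k + 1 ≤ (F.P K).m + (F.P K).K) (S : BgScheme F 2 𝒴 𝒵 K (k + 1))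
    (hR : S.RegimeTok) (Kc : GaugeField (F.P K) (k + 1) (SU 2) → Set 𝒴)
    (range : ∀ V ∈ S.dom, ∀ A ∈ Kc V, S.chart V A ∈ bgReg F 2 K (k + 1) θ.εbg ∧ Averaging.iter (avOfRecord F 2 K) (k + 1) (S.chart V A) = V)
    (covers : ∀ V ∈ S.dom, ∀ U : GaugeField (F.P K) 0 (SU 2), U ∈ bgReg F 2 K (k + 1) θ.εbg →
      Averaging.iter (avOfRecord F 2 K) (k + 1) U = V → ∃ A ∈ Kc V, OrbitRel (k + 1) (S.chart V A) U)
    (sol_of_isMinOn : ∀ V ∈ S.dom, ∀ A ∈ Kc V, IsMinOn (wilsonAction4 ∘ S.chart V) (Kc V) A →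
      ‖A‖ ≤ S.ε₄ ∧ mapT (S.𝒢 V) 0 (S.W V) (S.J V) (S.𝔄 V) A = A)
    (star_mem : ∀ V ∈ S.dom, S.sol V ∈ Kc V) (star_isMinOn : ∀ V ∈ S.dom, IsMinOn (wilsonAction4 ∘ S.chart V) (Kc V) (S.sol V))
    (hdom : letI := θ.instVβ₁; letI := θ.instVβ₂;
      ∀ᶠ B in 𝓝 (0 : Fin (F.P K).d → Site (F.P K) (k + 1) → θ.Vβ), unitField F θ k K B ∈ S.dom)
    (h1 : S.chartCfg 1 = 1)
    (hC : letI := θ.instVβ₁; letI := θ.instVβ₂;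
      ∀ b : PBond (F.P K) 0, ContDiffAt ℝ 2 (fun B : Fin (F.P K).d → Site (F.P K) (k + 1) → θ.Vβ =>
        ((S.chartCfg (unitField F θ k K B) b : SU 2) : MatA 2)) 0)
    (hwc : ∀ a l, ChartResponseWeaklyCriticalAt F θ k K (fun B => S.chartCfg (unitField F θ k K B)) a l) :
    (∀ (a : θ.ιβ) (l : RespLabel F k K),
      RootedResponseCriticalModGaugeAt F θ k K a l ∧ RootedResponseOrbitAt F θ k K a l ∧
        RootedResponseInvCriticalAt F θ k K a l ∧ RootedResponseConstraintModGaugeAt F θ k K a l) ∧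
    letI := θ.instVβ₁; letI := θ.instVβ₂
    ContDiffAt ℝ 2 (fun B : Fin (F.P K).d → Site (F.P K) (k + 1) → θ.Vβ =>
      fun (b : PBond (F.P K) 0) (i i' : Fin 2) => ((recordBgField F θ k K B b : SU 2) : Matrix (Fin 2) (Fin 2) ℂ) i i') 0 := by
  letI := θ.instVβ₁; letI := θ.instVβ₂
  have hfac := rootFactorAt_of_tokens_chart F θ k K hk S hR Kc range covers sol_of_isMinOn star_mem star_isMinOn hdom
  have hreg : ChartRegAt F θ k K fun B => S.chartCfg (unitField F θ k K B) := by
    refine ⟨?_, fun b => (hC b).differentiableAt (by simp)⟩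
    show S.chartCfg (unitField F θ k K 0) = 1
    rw [PortU8.unitField_zero, h1]
  exact ⟨fun a l => rootedReceipts_of_chart F θ k K hk _ hfac hreg a l (hwc a l),
    contDiffAt_recordBgField_entries_of_chart F θ k K _ hfac hC⟩

end Scheme

end Summit.QuantumFields.YangMills.Theorems.K0AxCtabUniq

end
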